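import Summits.BirchSwinnertonDyer.BirchSwinnertonDyer.Theorems.KolyvaginDepthDoorDepthTableKuriharaDecisivePrime
import HarnessLib

/-!
# Route `KolyvaginDepthDoor`, crux `KolyvaginDepthSupplyKN` (stmt-BirchSwinnertonDyer-22820) —
# DEPTH TABLE v22, KERNEL BRIDGES for «THE DECISIVE PAIR»: local `p`-indivisibility in `E(ℚ_q)` of an ARBITRARY
# rational point and of a COMBINATION `a • P₁ + b • P₂`, from `decide`-checked addition chains in `Ẽ(𝔽_q)`

Helper file of the lead prover of line `levelone` (kdd-p1 g26; `--supports stmt-BirchSwinnertonDyer-22820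
--as helper`); it closes nothing and BSD is NOT proved by it. Pure kernel plumbing (no named fact): v19's bridge
`localNondivisible_of_chainB[_rat]` (`…KuriharaDecisivePrime`, ONE point `(x, y)`) generalised to any rational point
`R` with `k • R̄ ≠ O`, `p·k = #Ẽ(𝔽_q)` (`localNondivisible_of_nsmul_reduceMod_ne_zero`: the reduction homomorphism
`Rank2Observatory.reduceMod` factors through `E(ℚ_q)`, AEC VII.2), and to `R = a • P₁ + b • P₂`
(`localNondivisible_combo_of_chains`: a chain for `a • P̄₁`, a chain for `b • P̄₂`, a chord certificate for the sum,
a chain to `k` on it — `Rank2Observatory.chainB` / `zmodChord` data). These discharge, per curve, the hypotheses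
`h01`/`h10`/`h1t` («the localisation matrix of the two Mordell–Weil generators at `(ℓ₁, ℓ₂)` is invertible mod
`p`») of `sha_inf_torsionBy_eq_bot_iff_kuriharaClaim_pair` (`…KuriharaDecisivePair`). BSD is NOT proved by any of this.

References: [SilvermanAEC2009] III.2.3 (group law), VII.2 Prop. 2.1, VII.3 Prop. 3.1; [Kurihara2014] §5.3 example (8)
(the matrix of `P = (2,−2)`, `Q = (−4,7)` at `13`, `103`, `109`).
-/

set_option linter.dupNamespace false

noncomputable section

open scoped Classical

namespace Summit.BirchSwinnertonDyer.BirchSwinnertonDyer.Theorems.KolyvaginDepthDoor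

open Literature.NumberTheory.EllipticCurves WeierstrassCurve
open Summit.BirchSwinnertonDyer.BirchSwinnertonDyer.Theorems
open Summit.BirchSwinnertonDyer.BirchSwinnertonDyer.Rank2Observatory

/-! ## KERNEL BRIDGES: local `p`-indivisibility at `q` of an arbitrary rational point / of a combination `a•P₁ + b•P₂` -/

section Bridge

variable (V : WeierstrassCurve ℤ) (q : ℕ) [Fact q.Prime]

/-- **KERNEL BRIDGE for an arbitrary rational point**: `q ∤ Δ(V)` prime, `R ∈ E(ℚ)` with `k • R̄ ≠ O` in `Ẽ(𝔽_q)`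
(`R̄ = reduceMod R`, `p·k = #Ẽ(𝔽_q)`) ⟹ `p • Q ≠ R` for every `Q ∈ E(ℚ_q)`: the reduction homomorphism FACTORS
through `E(ℚ_q)` (AEC VII.2), so `R = p·Q` would give `k • R̄ = #Ẽ • Q̄ = O` (v19's `localNondivisible_of_chainB[_rat]`
is the case `R = (x, y)`). [cite: SilvermanAEC2009, VII.2 Prop. 2.1, VII.3 Prop. 3.1] -/
theorem localNondivisible_of_nsmul_reduceMod_ne_zero (hq : ¬ (q : ℤ) ∣ V.Δ)
    (R : (V.map (Int.castRingHom ℚ)).toAffine.Point) {p k : ℕ}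
    (hpk : p * k = Nat.card (V.map (Int.castRingHom (ZMod q))).toAffine.Point)
    (hne : k • reduceMod V q hq R ≠ 0) :
    ∀ Q : ((V.map (Int.castRingHom ℚ)).baseChange ℚ_[q]).toAffine.Point,
      p • Q ≠ WeierstrassCurve.Affine.Point.map (W' := (V.map (Int.castRingHom ℚ)).toAffine) (S := ℚ)
        (Algebra.ofId ℚ ℚ_[q]) R := by
  intro Q hQ
  cases R with
  | zero =>
    apply hne
    change k • reduceMod V q hq 0 = 0
    rw [map_zero, nsmul_zero]
  | @some x y h =>
    -- `p • Q = (↑x, ↑y)` in `E(ℚ_q)`, transported to the `ℤ_q`-model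
    have hQ' : p • Q = .some (x : ℚ_[q]) (y : ℚ_[q]) (nonsingular_padic_of_rat V q h) :=
      hQ.trans (map_ofId_padic_some V q h)
    have h1 : p • Affine.Point.congrEquiv (rat_padic_model_eq V q) Q =
        .some (x : ℚ_[q]) (y : ℚ_[q]) (rat_padic_model_eq V q ▸ nonsingular_padic_of_rat V q h) := by
      rw [← map_nsmul, hQ', Affine.Point.congrEquiv_some]
    set ψ : ((V.map (Int.castRingHom ℤ_[q])).baseChange ℚ_[q]).toAffine.Point →+
        (V.map (Int.castRingHom (ZMod q))).toAffine.Point :=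
      (residuePointHom V q).comp (goodReductionHom (V.map (Int.castRingHom ℤ_[q])) (padicInt_valuationIntegers q)
        (isUnit_Δ_map_padicInt V q hq)) with hψ
    have h2 : reduceMod V q hq (.some x y h) = p • ψ (Affine.Point.congrEquiv (rat_padic_model_eq V q) Q) := by
      rw [reduceMod_some_eq_psi, ← map_nsmul, h1, hψ, AddMonoidHom.coe_comp, Function.comp_apply]
    apply hne
    rw [h2, ← mul_nsmul', mul_comm, hpk]
    exact card_nsmul_eq_zero'

/-- **KERNEL BRIDGE for a combination `a • P₁ + b • P₂`** (rational points, denominators prime to `q ∤ Δ(V)`,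
`p·k = #Ẽ(𝔽_q)`): `decide`-able DATA — a chain for `a • P̄₁` (`a = chainMult 1 stepsA`), a chain for `b • P̄₂`, a
CHORD certificate for their sum `(xC, yC)` and a chain from it reaching `k` — give `k • (a • P̄₁ + b • P̄₂) ≠ O`, hence
`p • Q ≠ a • P₁ + b • P₂` in `E(ℚ_q)` (reduction and base change are homomorphisms).
[cite: SilvermanAEC2009, III.2.3, VII.2 Prop. 2.1, VII.3 Prop. 3.1] -/
theorem localNondivisible_combo_of_chains (hq : ¬ (q : ℤ) ∣ V.Δ) {x₁ y₁ x₂ y₂ : ℚ}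
    (h₁ : (V.map (Int.castRingHom ℚ)).toAffine.Nonsingular x₁ y₁)
    (h₂ : (V.map (Int.castRingHom ℚ)).toAffine.Nonsingular x₂ y₂)
    (hx₁ : ¬ q ∣ x₁.den) (hy₁ : ¬ q ∣ y₁.den) (hx₂ : ¬ q ∣ x₂.den) (hy₂ : ¬ q ∣ y₂.den)
    {m₁ m₁' m₂ m₂' : ℤ} (hm₁ : (q : ℤ) ∣ x₁.num - m₁ * x₁.den) (hm₁' : (q : ℤ) ∣ y₁.num - m₁' * y₁.den)
    (hm₂ : (q : ℤ) ∣ x₂.num - m₂ * x₂.den) (hm₂' : (q : ℤ) ∣ y₂.num - m₂' * y₂.den)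
    {p k : ℕ} (hpk : p * k = Nat.card (V.map (Int.castRingHom (ZMod q))).toAffine.Point)
    {a b : ℕ} {stepsA stepsB stepsK : List (Bool × ZMod q × ZMod q)}
    (hA : chainB V q (m₁ : ZMod q) (m₁' : ZMod q) ((m₁ : ZMod q), (m₁' : ZMod q)) stepsA = true)
    (hmA : chainMult 1 stepsA = a)
    (hB : chainB V q (m₂ : ZMod q) (m₂' : ZMod q) ((m₂ : ZMod q), (m₂' : ZMod q)) stepsB = true)
    (hmB : chainMult 1 stepsB = b)
    {xC yC : ZMod q}
    (hC : zmodChord V q (chainLast ((m₁ : ZMod q), (m₁' : ZMod q)) stepsA).1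
        (chainLast ((m₁ : ZMod q), (m₁' : ZMod q)) stepsA).2
        (chainLast ((m₂ : ZMod q), (m₂' : ZMod q)) stepsB).1
        (chainLast ((m₂ : ZMod q), (m₂' : ZMod q)) stepsB).2 xC yC = true)
    (hK : chainB V q xC yC (xC, yC) stepsK = true) (hmK : chainMult 1 stepsK = k) :
    ∀ Q : ((V.map (Int.castRingHom ℚ)).baseChange ℚ_[q]).toAffine.Point,
      p • Q ≠ a • WeierstrassCurve.Affine.Point.map (W' := (V.map (Int.castRingHom ℚ)).toAffine) (S := ℚ)
          (Algebra.ofId ℚ ℚ_[q]) (Affine.Point.some x₁ y₁ h₁) +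
        b • WeierstrassCurve.Affine.Point.map (W' := (V.map (Int.castRingHom ℚ)).toAffine) (S := ℚ)
          (Algebra.ofId ℚ ℚ_[q]) (Affine.Point.some x₂ y₂ h₂) := by
  -- the reductions of `P₁`, `P₂`
  obtain ⟨h₁', e₁⟩ := reduceMod_some_rat V q hq h₁ hx₁ hy₁ hm₁ hm₁'
  obtain ⟨h₂', e₂⟩ := reduceMod_some_rat V q hq h₂ hx₂ hy₂ hm₂ hm₂'
  -- `a • P̄₁`, `b • P̄₂` from the two chains
  obtain ⟨hA', eA⟩ := exists_nsmul_eq_some_of_chainB V q h₁' stepsA ((m₁ : ZMod q), (m₁' : ZMod q)) 1 h₁'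
    (one_nsmul _) hA
  obtain ⟨hB', eB⟩ := exists_nsmul_eq_some_of_chainB V q h₂' stepsB ((m₂ : ZMod q), (m₂' : ZMod q)) 1 h₂'
    (one_nsmul _) hB
  rw [hmA] at eA; rw [hmB] at eB
  -- their sum from the chord certificate, and `k •` the sum is an affine point
  obtain ⟨hC', eC⟩ := exists_some_add_some_of_zmodChord V q hA' hB' hC
  have hneK := nsmul_ne_zero_of_chainB V q hC' hK
  rw [hmK] at hneK
  have hgen := localNondivisible_of_nsmul_reduceMod_ne_zero V q hq
    (a • Affine.Point.some x₁ y₁ h₁ + b • Affine.Point.some x₂ y₂ h₂) hpk (by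
      rw [map_add, map_nsmul, map_nsmul, e₁, e₂, eA, eB, eC]
      exact hneK)
  intro Q hQ
  rw [← map_nsmul, ← map_nsmul, ← map_add] at hQ
  exact hgen Q hQ

end Bridge

end Summit.BirchSwinnertonDyer.BirchSwinnertonDyer.Theorems.KolyvaginDepthDoor

end
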